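import Literature.MathematicalPhysics.QuantumFieldTheory.Balaban1983to89.B9GradViaDivLettersAtPinsL2
import Literature.MathematicalPhysics.QuantumFieldTheory.Balaban1983to89.Node00.OpsYNablaBridge
import Literature.MathematicalPhysics.QuantumFieldTheory.Balaban1983to89.Node00.OpsYBondLift

/-!
# `Balaban1983to89.B9DivGradStarKinematicsAtPins` — [B9] Theorem 3.13 (pp. 424–426): THE KINEMATICS OF THE SECOND-ORDER SOURCE WORD `G′D*_U∇*_U` OF ROWS 20–21
# AT NODE00-def-Y's LETTERS — `D*_U ∘ ∇*_U` (and `D*_U ∘ ∇*_{U,μ₀}`) decomposed into the DIRECTION letters `∇*_{U,μ}∇*_{U,ν}` of the site sector between slot-bookkeeping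
# maps, and the block-`L²` letters of those maps (slot copy, direction slice)

T. Bałaban, *Propagators for lattice gauge theories in a background field*, Commun. Math. Phys. **99** (1985) 389–434
[`Balaban1985BackgroundPropagators`, "B9"]; [4] = T. Bałaban, *Propagators and renormalization transformations for lattice gauge
theories. II*, Commun. Math. Phys. **96** (1984) 223–250 [`Balaban1984PropagatorsII`].

statement-level skeleton of published theorems with citation tags; proofs where landed; nothing here is a claim about the Yang–Mills mass gap

THE PRINTED LOCI.  (3.3) p. 390 and (3.8) p. 392 (the covariant derivative ∇_{U,μ} and its adjoint ∇\*_{U,μ}, the gauge-sector pair D_U ∕ D\*_U: *"(D\*_UA)(x) =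
Σ_μ …"*); p. 391 (*"we identify a function A on bonds with the vector function A_μ(x) = A(x, x + ηe_μ)"*); (3.152)–(3.153) p. 426 (𝔊 = G₁ − G₁DRD\*G₁ − …, RD\*G₁ =
RG′D\*: the words R∘D\*∘G₁∘∇\*_U = R∘G′∘D\*∘∇\*_U of Theorem 3.13's reduction); Theorem 3.1 (3.46) p. 398 (the block-L² lines of G′; *"max_{μ,ν}"* (3.39) p. 397);
[4] (2.45)–(2.46) p. 231 (blocks of neighbouring sites), (2.51)–(2.54) p. 232.

WHY THIS FILE (cell `pub-ymgap`, node N06 [B9], rows 20–21; seat `pub-ymgap-dag-n06-c` g21, after LOCATED-23∕24∕25: the last two displayed fields of the certificate's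
`hLL2` are `Letters313L2Pk.rgdDs` (R∘D\*∘G₁∘∇\*_U) and `Letters313L2MZ.rgdDd μ₀` (R∘D\*∘G₁∘∇\*_{U,μ₀}) in block L²; by (3.152) they are R∘G′∘(D\*∘∇\*_U) resp.
R∘G′∘(D\*∘∇\*_{U,μ₀}) — SECOND-ORDER source words of the site propagator G′, whose per-direction-pair block-L² line `G′∇\*_{U,μ}∇\*_{U,ν}` rows 18 carry
(`L2SecondLegs37`; n06-k∕w1 `l2line5_of_local37 ∕ l2line5_left_pairM`).  THIS FILE is the letter-level kinematics between the two:
* §1 the block-L² letters of the slot-bookkeeping maps at n06-d's coordinate carriers: `blockBd_slotCopyK` (copy one direction slot to all, factor d+1), `dist_sIK_bI_le`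
  + ★ `blockBd_dirSliceK` (the μ-components of the ν-slice of a bond-carrier vector as a site-carrier vector: factor (d+1)·e^{δ·rJ}, the site block of `z` and the bond
  block of `⟨z, μ⟩` being within `rJ`);
* §2 the identities: `dirSliceK_coordOpK_cdsB` (the bond-sector ∇\*_{U,·} acts componentwise: `dirSliceK μ ν ∘ (coordOpK b (ν′ ↦ ∇\*_{U,f ν′})) = c_f • ∇\*site_{U,f ν} ∘
  dirSliceK μ ν`, def-Y's `bondCompY_cdsB`), `GcoS_DscoS_apply_diag` (on the diagonal slot the bundled ∇\*_U of n06-d and the constant-slot direction letter agree after the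
  slot-constant G′), ★★ `GcoS_DvscoKH_DscoK_apply` ∕ ★★ `GcoS_DvscoKH_DdsB_apply` — `(G′∘D\*_U∘∇\*_U)B (z,ν,c,c′) = (c_fη)²·Σ_μ (G′∘∇\*_{U,μ}∘∇\*_{U,ν})(dirSliceK μ ν B)(z,μ,c,c′)`
  and the same with the constant-slot `∇\*_{U,μ₀}` (def-Y's `GcoS_DvscoKH_apply_eq_sum`), and their OPERATOR forms ★★ `GcoS_DvscoKH_DscoK_eq` ∕ ★★ `GcoS_DvscoKH_DdsB_eq`:
  `G′∘D\*_U∘∇\*_U = (c_fη)² • Σ_ν Π_ν ∘ Σ_μ slotCopy_μ ∘ (G′∘∇\*_{U,μ}∘∇\*_{U,ν}) ∘ dirSliceK μ ν` (Π_ν = `sliceProjK ν`).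
The direction letters are written VERBATIM as rows 18 display them (`(etaS i)⁻¹ • coordOpK b (fun _ => (cdsSL i (cfg U) μ).restrictScalars ℝ)` = the certificate's
`(𝔡 x).Dsd U μ`, pin `h𝔡s`), G′ as `GcoS … O U` (pin `hGpS`), D\*_U ∕ ∇\*_U as def-Y's `DvscoKH` ∕ `DscoK` (pins `hDvsco12 ∕ hDsco12`), ∇\*_{U,μ₀} on the bond
sector as `coordOpK b (fun _ => cdsBₗ i (cfg U) μ₀)` (the A-side pin `h𝔡As`).  Consumers: `B9Thm313WholeRgdSecondFrom3152` (the block-L² algebra and the (3.152)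
step) and the knit's leg `Summits/…/BalabanUVNodesN06RgdDsLegAtPinsPhysR`.

HONEST SCOPE.  Finite-dimensional letter algebra and block counting; no estimate of [B9] asserted; no pin or certificate edited; COUNT-NEUTRAL; N06 NOT discharged;
nothing continuum, nothing about the mass gap.  Cell `pub-ymgap` (HUMAN RULING D-0062), Track A node N06 [B9], seat `pub-ymgap-dag-n06-c` (g21), 2026-08-30; a NEW
file; 0 `def`, no `sorry`, no `axiom`, no `instance`, no `notation`.
-/

noncomputable section

namespace Literature.MathematicalPhysics.QuantumFieldTheory.Balaban1983to89.B9DivGradStarKinematicsAtPins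

open Node00 B6GlobalChartV1 B6KLevelCensusIndexV1 B9BackgroundsKLevelV1
open Node00.OpsYNablaBridge (chartY sum_bond_eq slotCopyK slotCopyK_apply dirSliceK dirSliceK_apply assembleK_dirSliceK coordOpK_apply4
  bondCompY bondCompY_apply GcoS_DvscoKH_apply_eq_sum)
open Node00.OpsYBondLift (bondCompY_cdsB)
open Node00.OpsYSectDCoords (DvscoKH)
open LatticeFieldCalculus (supDist)
open B6Geom246MultiLevelTorus (geomT)
open B6Ineq2142KLevelV1 (β)
open B9GeoNormsKLevelV1 (geo9K)
open B9GeoLemma21KLevelV1 (geo9K_dist_self)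
open B9Eq340NearPairBlocks (near_dist_carrier_le)
open B9Thm39ReadingCoords (cR39)
open B9Thm34Ext (toB6)
open B9SectDL2Decay (bsq bl2 bl2_nonneg bsq_nonneg bsq_eq_zero_of_loc BlockBd)
open B9Ineq349SiteComposite (cdsSL cdsSL_apply etaS_pos)
open B9CoReadingCoords (XBK assembleK assembleK_smul coordOpK assembleK_coordOpK cdsBₗ cdsBₗ_apply blkBK DscoK)
open B9CoReadingCoordsS (XSK blkSK sIK GcoS DscoS)
open B9GradViaDivLettersAtPins (rJ sliceProjK sliceProjK_apply)
open B9GradViaDivLettersAtPinsL2 (sum_sq_eq_bsq_of_loc)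

variable {𝔸 : Type} [NormedRing 𝔸] [NormedAlgebra ℂ 𝔸] [CompleteSpace 𝔸]
variable {d ℓ : ℕ} {hd : 1 ≤ d + 1} {hL : Odd (ℓ + 1) ∧ 1 < ℓ + 1} {b₀ b₁ : ℝ}
variable (i : KIdx d ℓ hd hL b₀ b₁)

/-! ## §1 The block-L² letters of the slot-bookkeeping maps -/

section Slots

variable {κ : Type} [Fintype κ]

omit [NormedAlgebra ℂ 𝔸] [CompleteSpace 𝔸] [NormedRing 𝔸] [Fintype κ] in
/-- `slotCopyK` on a general point of the carrier. [cite: Balaban1985BackgroundPropagators, (3.42) p.397, bookkeeping] -/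
theorem slotCopyK_apply' {S D : Type} (μ : D) (f : S × D × κ × κ → ℝ) (p : S × D × κ × κ) :
    slotCopyK (κ := κ) μ f p = f (p.1, μ, p.2.2) := rfl

omit [NormedAlgebra ℂ 𝔸] [CompleteSpace 𝔸] [NormedRing 𝔸] [Fintype κ] in
/-- `dirSliceK` on a general point of the site carrier. [cite: Balaban1985BackgroundPropagators, p.391, bookkeeping] -/
theorem dirSliceK_apply' (μ ν : Fin (d + 1)) (A : XBK κ i → ℝ) (p : XSK κ i) :
    dirSliceK (κ := κ) i μ ν A p = A (⟨(chartY i).symm p.1, μ⟩, ν, p.2.2) := rfl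

omit [NormedAlgebra ℂ 𝔸] [CompleteSpace 𝔸] [NormedRing 𝔸] [Fintype κ] in
/-- from a bound of block squares to a bound of block-L² sizes: `bsq₂ ≤ C²·bsq₁ ⇒ bl2₂ ≤ C·bl2₁` (`C ≥ 0`). [cite: Balaban1985BackgroundPropagators, (3.46) p.398, bookkeeping] -/
theorem bl2_le_of_bsq_le {G : B6.Geometry} {X₁ X₂ : Type} [Fintype X₁] [Fintype X₂] {blk₁ : X₁ → G.Site} {blk₂ : X₂ → G.Site}
    {y y' : G.Site} {f : X₁ → ℝ} {g : X₂ → ℝ} {C : ℝ} (hC : 0 ≤ C)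
    (h : bsq blk₂ y g ≤ C ^ 2 * bsq blk₁ y' f) : bl2 blk₂ y g ≤ C * bl2 blk₁ y' f := by
  calc bl2 blk₂ y g = Real.sqrt (bsq blk₂ y g) := rfl
    _ ≤ Real.sqrt (C ^ 2 * bsq blk₁ y' f) := Real.sqrt_le_sqrt h
    _ = C * bl2 blk₁ y' f := by rw [Real.sqrt_mul (sq_nonneg C), Real.sqrt_sq hC]; rfl

omit [NormedAlgebra ℂ 𝔸] [CompleteSpace 𝔸] [NormedRing 𝔸] [Fintype κ] in
/-- a sum over a product reading only the second factor is `card` times the sum over the second factor. [cite: Balaban1985BackgroundPropagators, (3.39) p.397 («max_μ»), bookkeeping] -/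
theorem sum_snd_eq {D E : Type} [Fintype D] [Fintype E] (h : E → ℝ) : ∑ t : D × E, h t.2 = (Fintype.card D : ℝ) * ∑ e, h e := by
  rw [Fintype.sum_prod_type]
  simp only [Finset.sum_const, Finset.card_univ, nsmul_eq_mul]

omit [NormedAlgebra ℂ 𝔸] [CompleteSpace 𝔸] [NormedRing 𝔸] [Fintype κ] in
/-- the part of a non-negative sum over a product with the first factor frozen is at most `card` times the whole sum (read through `sum_snd_eq`).
[cite: Balaban1985BackgroundPropagators, (3.39) p.397 («max_μ»), bookkeeping] -/
theorem sum_slot_le {D E : Type} [Fintype D] [Fintype E] (g : D × E → ℝ) (hg : ∀ t, 0 ≤ g t) (μ : D) :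
    ∑ t : D × E, g (μ, t.2) ≤ (Fintype.card D : ℝ) * ∑ t : D × E, g t := by
  rw [sum_snd_eq (fun e => g (μ, e)), Fintype.sum_prod_type]
  exact mul_le_mul_of_nonneg_left (Finset.single_le_sum (f := fun a => ∑ e : E, g (a, e)) (fun a _ => Finset.sum_nonneg fun e _ => hg (a, e))
    (Finset.mem_univ μ)) (Nat.cast_nonneg _)

omit [NormedAlgebra ℂ 𝔸] [CompleteSpace 𝔸] [NormedRing 𝔸] in
/-- ★ **THE BLOCK-L² LETTER OF THE SLOT COPY**: `slotCopyK μ` (the `μ`-slice copied to every direction slot) keeps the site of every entry, hence the block, and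
‖1_{Δ(y)}slotCopy_μ h‖₂² = (d+1)·(the μ-slot part of ‖1_{Δ(y)}h‖₂²) ≤ (d+1)²‖1_{Δ(y)}h‖₂²: the kernel `(d+1)·e^{−δd(y,y′)}` serves for every `δ` (`d(y,y) = 0`).
[cite: Balaban1985BackgroundPropagators, (3.39) p.397 («max_μ»), (3.46) p.398; Balaban1984PropagatorsII, (2.51) p.232 (bookkeeping)] -/
theorem blockBd_slotCopyK {δ : ℝ} (R₀ : ℝ) (H₀ : Prop) [Fintype (geo9K i).Site] (sI : SiteY i → IBondY i) (μ : Fin (d + 1)) :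
    BlockBd (g := toB6 (geo9K i) R₀ H₀) (blkSK (κ := κ) i sI) (blkSK (κ := κ) i sI) (slotCopyK (κ := κ) μ)
      (fun y y' => ((d : ℝ) + 1) * Real.exp (-(δ * (geo9K i).dist y y'))) := by
  classical
  intro y' f hoff y
  change IBondY i at y' y
  have hd0 : (0 : ℝ) ≤ (d : ℝ) + 1 := by positivity
  by_cases hy : y = y'
  · subst hy
    show _ ≤ ((d : ℝ) + 1) * Real.exp (-(δ * (geo9K i).dist y y)) * _
    rw [geo9K_dist_self, mul_zero, neg_zero, Real.exp_zero, mul_one]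
    refine bl2_le_of_bsq_le hd0 ?_
    -- the block square of the copy is (d+1) × the μ-slot part of the block square of `f`
    have key : bsq (g := toB6 (geo9K i) R₀ H₀) (blkSK (κ := κ) i sI) y (slotCopyK (κ := κ) μ f) ≤
        ((d : ℝ) + 1) * bsq (g := toB6 (geo9K i) R₀ H₀) (blkSK (κ := κ) i sI) y f := by
      -- both functions vanish off the block `y`, so the block squares are plain sums of squares
      have hoff' : ∀ p : XSK κ i, blkSK (κ := κ) i sI p ≠ y → slotCopyK (κ := κ) μ f p = 0 := fun p hp => hoff (p.1, μ, p.2.2) hp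
      rw [← sum_sq_eq_bsq_of_loc (G := toB6 (geo9K i) R₀ H₀) (blkSK (κ := κ) i sI) hoff',
        ← sum_sq_eq_bsq_of_loc (G := toB6 (geo9K i) R₀ H₀) (blkSK (κ := κ) i sI) hoff]
      simp only [slotCopyK_apply']
      conv_lhs => rw [Fintype.sum_prod_type]
      conv_rhs => rw [Fintype.sum_prod_type, Finset.mul_sum]
      refine Finset.sum_le_sum fun w _ => ?_
      have h := sum_slot_le (fun t : Fin (d + 1) × (κ × κ) => f (w, t) ^ 2) (fun t => sq_nonneg _) μ
      rw [Fintype.card_fin, Nat.cast_add, Nat.cast_one] at h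
      exact h
    calc bsq (g := toB6 (geo9K i) R₀ H₀) (blkSK (κ := κ) i sI) y (slotCopyK (κ := κ) μ f)
        ≤ ((d : ℝ) + 1) * bsq (g := toB6 (geo9K i) R₀ H₀) (blkSK (κ := κ) i sI) y f := key
      _ ≤ ((d : ℝ) + 1) ^ 2 * bsq (g := toB6 (geo9K i) R₀ H₀) (blkSK (κ := κ) i sI) y f := by
          refine mul_le_mul_of_nonneg_right ?_ (bsq_nonneg _ _ _)
          have hd1 : (1 : ℝ) ≤ (d : ℝ) + 1 := by linarith [(Nat.cast_nonneg d : (0 : ℝ) ≤ d)]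
          nlinarith
  · have h0 : bsq (g := toB6 (geo9K i) R₀ H₀) (blkSK (κ := κ) i sI) y (slotCopyK (κ := κ) μ f) = 0 :=
      bsq_eq_zero_of_loc (g := toB6 (geo9K i) R₀ H₀) (blkSK (κ := κ) i sI) hy _ fun p hp => hoff (p.1, μ, p.2.2) hp
    show Real.sqrt _ ≤ _
    rw [h0, Real.sqrt_zero]
    exact mul_nonneg (by positivity) (bl2_nonneg _ _ _)

omit [NormedAlgebra ℂ 𝔸] [CompleteSpace 𝔸] [NormedRing 𝔸] [Fintype κ] in
/-- **THE SITE BLOCK OF `z` AND THE INDEX BLOCK OF THE BOND `⟨z, μ⟩` ARE WITHIN `rJ`** (a 1-faithful carrier map `bI`, `hβ1`; n06-w6's `near_dist_carrier_le` at the pair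
`⟨z, e₀⟩`, `⟨z, μ⟩` of sup-distance 0). [cite: Balaban1984PropagatorsII, (2.45)–(2.46) p.231; Balaban1985BackgroundPropagators, p.391 (bookkeeping)] -/
theorem dist_sIK_bI_le {bI : FBondY i → IBondY i}
    (hβ1 : ∀ f : FBondY i, (geomT i.D).dist (β i.hN i.D i.hk (bI f)) (blkV1 i.hN i.D f) ≤ 1)
    (s : Site (PV d ℓ i.m i.K hd hL) 0) (μ : Fin (d + 1)) :
    (geo9K i).dist (sIK i bI (chartY i s)) (bI ⟨s, μ⟩) ≤ rJ d ℓ := by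
  have hss : supDist s s = 0 := by unfold supDist; simp
  have hnear : supDist (⟨s, (0 : Fin (d + 1))⟩ : FBondY i).src (⟨s, μ⟩ : FBondY i).src ≤ (ℓ + 1) ^ (blkV1 i.hN i.D (⟨s, 0⟩ : FBondY i)).1.1 := by
    show supDist s s ≤ _
    rw [hss]
    exact Nat.zero_le _
  have e : sIK i bI (chartY i s) = bI ⟨s, 0⟩ := by
    show bI ⟨(boxEquiv i.hN).symm (boxEquiv i.hN s), 0⟩ = bI ⟨s, 0⟩
    rw [Equiv.symm_apply_apply]
  have h := near_dist_carrier_le i hβ1 hnear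
  rw [e]
  show (geomT i.D).dist (β i.hN i.D i.hk (bI ⟨s, 0⟩)) (β i.hN i.D i.hk (bI ⟨s, μ⟩)) ≤ rJ d ℓ
  exact h

omit [NormedAlgebra ℂ 𝔸] [CompleteSpace 𝔸] [NormedRing 𝔸] in
/-- ★ **THE BLOCK-L² LETTER OF THE DIRECTION SLICE `dirSliceK μ ν`** (bond-carrier vectors → site-carrier vectors, (μ-components of the ν-slice) copied to every
slot; block maps `blkBK bI` → `blkSK (sIK bI)`, `bI` 1-faithful): ‖1_{Δ(y)}dirSliceK μ ν B‖₂² ≤ (d+1)·‖1_{Δ(y′)}B‖₂² for `supp B ⊂ Δ(y′)`, and `= 0` unless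
`d(y,y′) ≤ rJ` — kernel `(d+1)·e^{δ·rJ}·e^{−δd(y,y′)}`, every `δ ≥ 0`. [cite: Balaban1985BackgroundPropagators, p.391 («A_μ(x) = A(x, x+ηe_μ)»), (3.46) p.398; Balaban1984PropagatorsII, (2.45)–(2.46) p.231, (2.51) p.232] -/
theorem blockBd_dirSliceK {bI : FBondY i → IBondY i}
    (hβ1 : ∀ f : FBondY i, (geomT i.D).dist (β i.hN i.D i.hk (bI f)) (blkV1 i.hN i.D f) ≤ 1)
    {δ : ℝ} (hδ : 0 ≤ δ) (R₀ : ℝ) (H₀ : Prop) [Fintype (geo9K i).Site] (μ ν : Fin (d + 1)) :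
    BlockBd (g := toB6 (geo9K i) R₀ H₀) (blkBK (κ := κ) i bI) (blkSK (κ := κ) i (sIK i bI)) (dirSliceK (κ := κ) i μ ν)
      (fun y y' => ((d : ℝ) + 1) * Real.exp (δ * rJ d ℓ) * Real.exp (-(δ * (geo9K i).dist y y'))) := by
  classical
  intro y' B hoff y
  change IBondY i at y' y
  set K : ℝ := ((d : ℝ) + 1) * Real.exp (δ * rJ d ℓ) * Real.exp (-(δ * (geo9K i).dist y y')) with hK
  have hd0 : (0 : ℝ) ≤ (d : ℝ) + 1 := by positivity
  have hK0 : 0 ≤ K := by positivity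
  -- the (ν-slice, μ-direction) part of the squares of `B` at a torus site
  set gz : SiteY i → ℝ := fun w => ∑ t : κ × κ, B (⟨(chartY i).symm w, μ⟩, ν, t) ^ 2 with hgz
  have hgz0 : ∀ w, 0 ≤ gz w := fun w => by positivity
  -- the target block square is at most (d+1) × Σ_w gz w
  have htgt : bsq (g := toB6 (geo9K i) R₀ H₀) (blkSK (κ := κ) i (sIK i bI)) y (dirSliceK (κ := κ) i μ ν B) ≤ ((d : ℝ) + 1) * ∑ w : SiteY i, gz w := by
    unfold bsq
    rw [Fintype.sum_prod_type, Finset.mul_sum]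
    refine Finset.sum_le_sum fun w _ => ?_
    refine le_trans (Finset.sum_le_sum (g := fun t : Fin (d + 1) × κ × κ => dirSliceK (κ := κ) i μ ν B (w, t) ^ 2) fun t _ => ?_) (le_of_eq ?_)
    · split_ifs
      · exact le_rfl
      · exact sq_nonneg _
    · simp only [dirSliceK_apply']
      have h := sum_snd_eq (D := Fin (d + 1)) (fun s : κ × κ => B (⟨(chartY i).symm w, μ⟩, ν, s) ^ 2)
      rw [Fintype.card_fin, Nat.cast_add, Nat.cast_one] at h
      exact h
  -- the source block square dominates Σ_w gz w
  have hsrc : ∑ w : SiteY i, gz w ≤ bsq (g := toB6 (geo9K i) R₀ H₀) (blkBK (κ := κ) i bI) y' B := by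
    have hfull : bsq (g := toB6 (geo9K i) R₀ H₀) (blkBK (κ := κ) i bI) y' B = ∑ q : XBK κ i, B q ^ 2 := by
      unfold bsq
      refine Finset.sum_congr rfl fun q _ => ?_
      split_ifs with hq
      · rfl
      · rw [hoff q hq]; ring
    rw [hfull, Fintype.sum_prod_type, sum_bond_eq]
    rw [← Fintype.sum_equiv (chartY i) (fun s : Site (PV d ℓ i.m i.K hd hL) 0 => gz (chartY i s)) gz (fun _ => rfl)]
    refine Finset.sum_le_sum fun s _ => ?_
    have h1 : gz (chartY i s) ≤ ∑ t : Fin (d + 1) × κ × κ, B (⟨s, μ⟩, t) ^ 2 := by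
      simp only [hgz, Equiv.symm_apply_apply]
      rw [Fintype.sum_prod_type (f := fun t : Fin (d + 1) × κ × κ => B (⟨s, μ⟩, t) ^ 2)]
      exact Finset.single_le_sum (f := fun ν' : Fin (d + 1) => ∑ t : κ × κ, B (⟨s, μ⟩, ν', t) ^ 2)
        (fun ν' _ => Finset.sum_nonneg fun t _ => sq_nonneg _) (Finset.mem_univ ν)
    exact h1.trans (Finset.single_le_sum (f := fun μ' : Fin (d + 1) => ∑ t : Fin (d + 1) × κ × κ, B (⟨s, μ'⟩, t) ^ 2)
      (fun μ' _ => Finset.sum_nonneg fun t _ => sq_nonneg _) (Finset.mem_univ μ))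
  refine bl2_le_of_bsq_le hK0 ?_
  have hb0 : 0 ≤ bsq (g := toB6 (geo9K i) R₀ H₀) (blkBK (κ := κ) i bI) y' B := bsq_nonneg _ _ _
  by_cases hnear : (geo9K i).dist y y' ≤ rJ d ℓ
  · have hK1 : 1 ≤ Real.exp (δ * rJ d ℓ) * Real.exp (-(δ * (geo9K i).dist y y')) := by
      rw [← Real.exp_add]
      exact Real.one_le_exp (by nlinarith [mul_le_mul_of_nonneg_left hnear hδ])
    have hK2 : (d : ℝ) + 1 ≤ K := by
      rw [hK, mul_assoc]
      have := mul_le_mul_of_nonneg_left hK1 hd0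
      rwa [mul_one] at this
    calc bsq (g := toB6 (geo9K i) R₀ H₀) (blkSK (κ := κ) i (sIK i bI)) y (dirSliceK (κ := κ) i μ ν B)
        ≤ ((d : ℝ) + 1) * bsq (g := toB6 (geo9K i) R₀ H₀) (blkBK (κ := κ) i bI) y' B := htgt.trans (mul_le_mul_of_nonneg_left hsrc hd0)
      _ ≤ K ^ 2 * bsq (g := toB6 (geo9K i) R₀ H₀) (blkBK (κ := κ) i bI) y' B := by
          refine mul_le_mul_of_nonneg_right ?_ hb0
          have hd1 : (1 : ℝ) ≤ (d : ℝ) + 1 := by linarith [(Nat.cast_nonneg d : (0 : ℝ) ≤ d)]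
          nlinarith
  · -- far blocks: every term of the target block square vanishes
    have hzero : bsq (g := toB6 (geo9K i) R₀ H₀) (blkSK (κ := κ) i (sIK i bI)) y (dirSliceK (κ := κ) i μ ν B) = 0 := by
      unfold bsq
      refine Finset.sum_eq_zero fun p _ => ?_
      split_ifs with hp
      · rw [dirSliceK_apply']
        have hq : blkBK (κ := κ) i bI (⟨(chartY i).symm p.1, μ⟩, ν, p.2.2) ≠ y' := fun h => hnear (by
          have hp' : sIK i bI p.1 = y := hp
          rw [← hp', ← h]
          have hdist := dist_sIK_bI_le i hβ1 (bI := bI) ((chartY i).symm p.1) μ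
          rwa [Equiv.apply_symm_apply] at hdist)
        rw [hoff _ hq]; ring
      · rfl
    rw [hzero]; positivity

end Slots

/-! ## §2 The decompositions of `G′∘D*_U∘∇*_U` and `G′∘D*_U∘∇*_{U,μ₀}` into the direction letters -/

section Letters

variable {κ : Type} [Fintype κ] (b : Module.Basis κ ℝ 𝔸) [FiniteDimensional ℝ 𝔸] (B : B9.Backgrounds) (cfg : B.Cfg → CfgY 𝔸 i) (O : SiteOpY 𝔸 i)

omit [FiniteDimensional ℝ 𝔸] in
/-- **THE BOND-SECTOR `∇*_{U,·}` ACTS COMPONENTWISE**: slicing the coordinate model of a direction-indexed family `ν′ ↦ ∇*_{U,f ν′}` on the bond carrier at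
`(μ, ν)` is `c_f` times the constant-slot site-sector letter `∇*_{U,f ν}` after the slice (def-Y's `bondCompY_cdsB`).
[cite: Balaban1985BackgroundPropagators, (3.8) p.392, p.391 («componentwise»)] -/
theorem dirSliceK_coordOpK_cdsB (U₁ : B.Cfg) (f : Fin (d + 1) → Fin (d + 1)) (μ ν : Fin (d + 1)) (A : XBK κ i → ℝ) :
    dirSliceK (κ := κ) i μ ν (coordOpK b (fun ν' : Fin (d + 1) => cdsBₗ i (cfg U₁) (f ν')) A) =
      (i.cf : ℝ) • coordOpK b (fun _ : Fin (d + 1) => (cdsSL i (cfg U₁) (f ν)).restrictScalars ℝ) (dirSliceK (κ := κ) i μ ν A) := by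
  funext p
  obtain ⟨w, μ', a, c⟩ := p
  rw [dirSliceK_apply, Pi.smul_apply, smul_eq_mul, coordOpK_apply4, coordOpK_apply4, cdsBₗ_apply, LinearMap.restrictScalars_apply, cdsSL_apply,
    assembleK_dirSliceK]
  have h := congrFun (bondCompY_cdsB i (cfg U₁) (f ν) μ (assembleK b ν c A)) w
  rw [bondCompY_apply] at h
  rw [h, Pi.smul_apply, Complex.coe_smul, map_smul, Finsupp.smul_apply, smul_eq_mul]

omit [FiniteDimensional ℝ 𝔸] in
/-- the same for the bundled `∇*_U` of n06-d (`DscoK`, slot = direction): `dirSliceK μ ν (DscoK A) = c_f • ∇*site_{U,ν} (dirSliceK μ ν A)`.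
[cite: Balaban1985BackgroundPropagators, (3.8) p.392, (3.42) p.397 («G(U)∇*_U»)] -/
theorem dirSliceK_DscoK (U₁ : B.Cfg) (μ ν : Fin (d + 1)) (A : XBK κ i → ℝ) :
    dirSliceK (κ := κ) i μ ν (DscoK i b B cfg U₁ A) =
      (i.cf : ℝ) • coordOpK b (fun _ : Fin (d + 1) => (cdsSL i (cfg U₁) ν).restrictScalars ℝ) (dirSliceK (κ := κ) i μ ν A) :=
  dirSliceK_coordOpK_cdsB i b B cfg U₁ id μ ν A

omit [FiniteDimensional ℝ 𝔸] in
/-- the same for the constant-slot `∇*_{U,μ₀}` of the bond sector (the A-side direction letter, pin `h𝔡As`): `dirSliceK μ ν (∇*_{U,μ₀} A) = c_f • ∇*site_{U,μ₀} (dirSliceK μ ν A)`.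
[cite: Balaban1985BackgroundPropagators, (3.8) p.392, (3.39) p.397] -/
theorem dirSliceK_DdsB (U₁ : B.Cfg) (μ₀ μ ν : Fin (d + 1)) (A : XBK κ i → ℝ) :
    dirSliceK (κ := κ) i μ ν (coordOpK b (fun _ : Fin (d + 1) => cdsBₗ i (cfg U₁) μ₀) A) =
      (i.cf : ℝ) • coordOpK b (fun _ : Fin (d + 1) => (cdsSL i (cfg U₁) μ₀).restrictScalars ℝ) (dirSliceK (κ := κ) i μ ν A) :=
  dirSliceK_coordOpK_cdsB i b B cfg U₁ (fun _ => μ₀) μ ν A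

/-- **ON THE DIAGONAL SLOT THE BUNDLED AND THE CONSTANT-SLOT `∇*` AGREE AFTER THE SLOT-CONSTANT `G′`**: `(G′∘∇*_U)g (z,μ,c,c′) = (G′∘∇*_{U,μ})g (z,μ,c,c′)`
(`GcoS` reads one slot; `DscoS`'s slot-μ entry is `∇*_{U,μ}` of the slot-μ slice). [cite: Balaban1985BackgroundPropagators, (3.42) p.397, (3.39) p.397 (bookkeeping)] -/
theorem GcoS_DscoS_apply_diag (U₁ : B.Cfg) (g : XSK κ i → ℝ) (z : SiteY i) (μ : Fin (d + 1)) (c c' : κ) :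
    (GcoS i b B cfg O U₁ ∘ₗ DscoS i b B cfg U₁) g (z, μ, c, c') =
      (GcoS i b B cfg O U₁ ∘ₗ ((etaS i)⁻¹ • coordOpK b (fun _ : Fin (d + 1) => (cdsSL i (cfg U₁) μ).restrictScalars ℝ))) g (z, μ, c, c') := by
  simp only [GcoS, DscoS, LinearMap.comp_apply, LinearMap.smul_apply, Pi.smul_apply, smul_eq_mul, coordOpK_apply4, assembleK_smul,
    assembleK_coordOpK]

/-- ★★ **`G′∘D*_U∘∇*_U` IN THE DIRECTION LETTERS, POINTWISE**: `(G′∘D*_U∘∇*_U)B (z, ν, c, c′) = (c_fη)²·Σ_μ (G′∘∇*_{U,μ}∘∇*_{U,ν})(dirSliceK μ ν B)(z, μ, c, c′)` —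
def-Y's bridge `GcoS_DvscoKH_apply_eq_sum` (D\*_U = c_fη·Σ_μ ∇*site_{U,μ} on the μ-components), `dirSliceK_DscoK` (∇*_U componentwise) and the diagonal-slot agreement.
[cite: Balaban1985BackgroundPropagators, (3.8) p.392, (3.152)–(3.153) p.426 (the word G′D*∇*), (3.46) p.398] -/
theorem GcoS_DvscoKH_DscoK_apply (U₁ : B.Cfg) (A : XBK κ i → ℝ) (z : SiteY i) (ν : Fin (d + 1)) (c c' : κ) :
    (GcoS i b B cfg O U₁ ∘ₗ DvscoKH i b B cfg U₁ ∘ₗ DscoK i b B cfg U₁) A (z, ν, c, c') =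
      (i.cf * etaS i) ^ 2 * ∑ μ : Fin (d + 1),
        (GcoS i b B cfg O U₁ ∘ₗ ((etaS i)⁻¹ • coordOpK b (fun _ : Fin (d + 1) => (cdsSL i (cfg U₁) μ).restrictScalars ℝ)) ∘ₗ
          ((etaS i)⁻¹ • coordOpK b (fun _ : Fin (d + 1) => (cdsSL i (cfg U₁) ν).restrictScalars ℝ))) (dirSliceK (κ := κ) i μ ν A) (z, μ, c, c') := by
  have hη : etaS i ≠ 0 := (etaS_pos i).ne'
  have key : ∀ μ : Fin (d + 1), (GcoS i b B cfg O U₁ ∘ₗ DscoS i b B cfg U₁) (dirSliceK (κ := κ) i μ ν (DscoK i b B cfg U₁ A)) (z, μ, c, c') =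
      (i.cf * etaS i) * (GcoS i b B cfg O U₁ ∘ₗ ((etaS i)⁻¹ • coordOpK b (fun _ : Fin (d + 1) => (cdsSL i (cfg U₁) μ).restrictScalars ℝ)) ∘ₗ
          ((etaS i)⁻¹ • coordOpK b (fun _ : Fin (d + 1) => (cdsSL i (cfg U₁) ν).restrictScalars ℝ))) (dirSliceK (κ := κ) i μ ν A) (z, μ, c, c') := by
    intro μ
    rw [dirSliceK_DscoK, map_smul, Pi.smul_apply, smul_eq_mul, GcoS_DscoS_apply_diag]
    simp only [LinearMap.comp_apply, LinearMap.smul_apply, map_smul, Pi.smul_apply, smul_eq_mul]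
    field_simp
  rw [show (GcoS i b B cfg O U₁ ∘ₗ DvscoKH i b B cfg U₁ ∘ₗ DscoK i b B cfg U₁) A = (GcoS i b B cfg O U₁ ∘ₗ DvscoKH i b B cfg U₁) (DscoK i b B cfg U₁ A) from rfl,
    GcoS_DvscoKH_apply_eq_sum i b B cfg O U₁ (DscoK i b B cfg U₁ A) z ν c c', Finset.sum_congr rfl (fun μ _ => key μ), ← Finset.mul_sum]
  ring

/-- ★★ the same for the constant-slot right letter `∇*_{U,μ₀}` of the bond sector: `(G′∘D*_U∘∇*_{U,μ₀})B (z, ν, c, c′) =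
(c_fη)²·Σ_μ (G′∘∇*_{U,μ}∘∇*_{U,μ₀})(dirSliceK μ ν B)(z, μ, c, c′)`. [cite: Balaban1985BackgroundPropagators, (3.8) p.392, (3.152)–(3.153) p.426, (3.39) p.397] -/
theorem GcoS_DvscoKH_DdsB_apply (U₁ : B.Cfg) (μ₀ : Fin (d + 1)) (A : XBK κ i → ℝ) (z : SiteY i) (ν : Fin (d + 1)) (c c' : κ) :
    (GcoS i b B cfg O U₁ ∘ₗ DvscoKH i b B cfg U₁ ∘ₗ coordOpK b (fun _ : Fin (d + 1) => cdsBₗ i (cfg U₁) μ₀)) A (z, ν, c, c') =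
      (i.cf * etaS i) ^ 2 * ∑ μ : Fin (d + 1),
        (GcoS i b B cfg O U₁ ∘ₗ ((etaS i)⁻¹ • coordOpK b (fun _ : Fin (d + 1) => (cdsSL i (cfg U₁) μ).restrictScalars ℝ)) ∘ₗ
          ((etaS i)⁻¹ • coordOpK b (fun _ : Fin (d + 1) => (cdsSL i (cfg U₁) μ₀).restrictScalars ℝ))) (dirSliceK (κ := κ) i μ ν A) (z, μ, c, c') := by
  have hη : etaS i ≠ 0 := (etaS_pos i).ne'
  have key : ∀ μ : Fin (d + 1),
      (GcoS i b B cfg O U₁ ∘ₗ DscoS i b B cfg U₁) (dirSliceK (κ := κ) i μ ν (coordOpK b (fun _ : Fin (d + 1) => cdsBₗ i (cfg U₁) μ₀) A)) (z, μ, c, c') =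
      (i.cf * etaS i) * (GcoS i b B cfg O U₁ ∘ₗ ((etaS i)⁻¹ • coordOpK b (fun _ : Fin (d + 1) => (cdsSL i (cfg U₁) μ).restrictScalars ℝ)) ∘ₗ
          ((etaS i)⁻¹ • coordOpK b (fun _ : Fin (d + 1) => (cdsSL i (cfg U₁) μ₀).restrictScalars ℝ))) (dirSliceK (κ := κ) i μ ν A) (z, μ, c, c') := by
    intro μ
    rw [dirSliceK_DdsB, map_smul, Pi.smul_apply, smul_eq_mul, GcoS_DscoS_apply_diag]
    simp only [LinearMap.comp_apply, LinearMap.smul_apply, map_smul, Pi.smul_apply, smul_eq_mul]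
    field_simp
  rw [show (GcoS i b B cfg O U₁ ∘ₗ DvscoKH i b B cfg U₁ ∘ₗ coordOpK b (fun _ : Fin (d + 1) => cdsBₗ i (cfg U₁) μ₀)) A =
      (GcoS i b B cfg O U₁ ∘ₗ DvscoKH i b B cfg U₁) (coordOpK b (fun _ : Fin (d + 1) => cdsBₗ i (cfg U₁) μ₀) A) from rfl,
    GcoS_DvscoKH_apply_eq_sum i b B cfg O U₁ (coordOpK b (fun _ : Fin (d + 1) => cdsBₗ i (cfg U₁) μ₀) A) z ν c c',
    Finset.sum_congr rfl (fun μ _ => key μ), ← Finset.mul_sum]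
  ring

/-- ★★ **THE OPERATOR FORM**: `G′∘D*_U∘∇*_U = (c_fη)² • Σ_ν Π_ν ∘ Σ_μ slotCopy_μ ∘ (G′∘∇*_{U,μ}∘∇*_{U,ν}) ∘ dirSliceK μ ν` (Π_ν = `sliceProjK ν`, slotCopy_μ = `slotCopyK μ`).
[cite: Balaban1985BackgroundPropagators, (3.8) p.392, (3.152)–(3.153) p.426, (3.46) p.398] -/
theorem GcoS_DvscoKH_DscoK_eq (U₁ : B.Cfg) :
    GcoS i b B cfg O U₁ ∘ₗ DvscoKH i b B cfg U₁ ∘ₗ DscoK i b B cfg U₁ =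
      (i.cf * etaS i) ^ 2 • ∑ ν : Fin (d + 1), sliceProjK (κ := κ) ν ∘ₗ ∑ μ : Fin (d + 1), slotCopyK (κ := κ) μ ∘ₗ
        ((GcoS i b B cfg O U₁ ∘ₗ ((etaS i)⁻¹ • coordOpK b (fun _ : Fin (d + 1) => (cdsSL i (cfg U₁) μ).restrictScalars ℝ)) ∘ₗ
          ((etaS i)⁻¹ • coordOpK b (fun _ : Fin (d + 1) => (cdsSL i (cfg U₁) ν).restrictScalars ℝ))) ∘ₗ dirSliceK (κ := κ) i μ ν) := by
  apply LinearMap.ext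
  intro A
  funext p
  obtain ⟨z, ν, c, c'⟩ := p
  rw [GcoS_DvscoKH_DscoK_apply]
  simp only [LinearMap.smul_apply, Pi.smul_apply, smul_eq_mul, LinearMap.coe_sum, Finset.sum_apply, LinearMap.comp_apply, sliceProjK_apply,
    slotCopyK_apply']
  congr 1
  rw [Finset.sum_ite_eq Finset.univ ν, if_pos (Finset.mem_univ ν)]

/-- ★★ the operator form for `∇*_{U,μ₀}`: `G′∘D*_U∘∇*_{U,μ₀} = (c_fη)² • Σ_ν Π_ν ∘ Σ_μ slotCopy_μ ∘ (G′∘∇*_{U,μ}∘∇*_{U,μ₀}) ∘ dirSliceK μ ν`.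
[cite: Balaban1985BackgroundPropagators, (3.8) p.392, (3.152)–(3.153) p.426, (3.39) p.397] -/
theorem GcoS_DvscoKH_DdsB_eq (U₁ : B.Cfg) (μ₀ : Fin (d + 1)) :
    GcoS i b B cfg O U₁ ∘ₗ DvscoKH i b B cfg U₁ ∘ₗ coordOpK b (fun _ : Fin (d + 1) => cdsBₗ i (cfg U₁) μ₀) =
      (i.cf * etaS i) ^ 2 • ∑ ν : Fin (d + 1), sliceProjK (κ := κ) ν ∘ₗ ∑ μ : Fin (d + 1), slotCopyK (κ := κ) μ ∘ₗ
        ((GcoS i b B cfg O U₁ ∘ₗ ((etaS i)⁻¹ • coordOpK b (fun _ : Fin (d + 1) => (cdsSL i (cfg U₁) μ).restrictScalars ℝ)) ∘ₗ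
          ((etaS i)⁻¹ • coordOpK b (fun _ : Fin (d + 1) => (cdsSL i (cfg U₁) μ₀).restrictScalars ℝ))) ∘ₗ dirSliceK (κ := κ) i μ ν) := by
  apply LinearMap.ext
  intro A
  funext p
  obtain ⟨z, ν, c, c'⟩ := p
  rw [GcoS_DvscoKH_DdsB_apply]
  simp only [LinearMap.smul_apply, Pi.smul_apply, smul_eq_mul, LinearMap.coe_sum, Finset.sum_apply, LinearMap.comp_apply, sliceProjK_apply,
    slotCopyK_apply']
  congr 1
  rw [Finset.sum_ite_eq Finset.univ ν, if_pos (Finset.mem_univ ν)]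

end Letters

/-! ## §3 The block-L² letter of the slice projection on ANY slot carrier (appended, dag-n06-c g21) -/

section ProjAny

variable {κ : Type} [Fintype κ]

omit [NormedAlgebra ℂ 𝔸] [CompleteSpace 𝔸] [NormedRing 𝔸] in
/-- ★ **THE BLOCK-L² LETTER OF `Π_ν` ON ANY SLOT CARRIER** `S × Fin (d+1) × κ × κ` (dag-n06-l's `B9GradViaDivLettersAtPinsL2.blockBd_sliceProjK` is the bond-carrier
case `S = FBondY`; the site carrier `XSK` = `SiteY × …` is what `GcoS_DvscoKH_DscoK_eq`'s outer projections act on): `‖1_{Δ(y)}Π_νf‖₂ ≤ ‖1_{Δ(y)}f‖₂` and `Π_ν`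
preserves supports, so the kernel `1·e^{−δd(y,y′)}` serves for every `δ`. Proof verbatim dag-n06-l's.
[cite: Balaban1985BackgroundPropagators, (3.46) p.398, (3.42) p.397 (all directions); Balaban1984PropagatorsII, (2.51) p.232] -/
theorem blockBd_sliceProjK_any {S : Type} [Fintype S] {δ : ℝ} (R₀ : ℝ) (H₀ : Prop) [Fintype (geo9K i).Site] (blk : S × Fin (d + 1) × κ × κ → IBondY i)
    (ν : Fin (d + 1)) :
    BlockBd (g := toB6 (geo9K i) R₀ H₀) blk blk (sliceProjK (κ := κ) ν) (fun y y' => (1 : ℝ) * Real.exp (-(δ * (geo9K i).dist y y'))) := by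
  classical
  intro y' f hoff y
  change IBondY i at y' y
  by_cases hy : y = y'
  · subst hy
    show _ ≤ (1 : ℝ) * Real.exp (-(δ * (geo9K i).dist y y)) * _
    rw [geo9K_dist_self, mul_zero, neg_zero, Real.exp_zero, one_mul, one_mul]
    have hsq : bsq (g := toB6 (geo9K i) R₀ H₀) blk y (sliceProjK (κ := κ) ν f) ≤ bsq (g := toB6 (geo9K i) R₀ H₀) blk y f := by
      unfold bsq
      refine Finset.sum_le_sum fun p _ => ?_
      split_ifs with hp
      · rw [sliceProjK_apply]
        split_ifs
        · exact le_rfl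
        · simpa using sq_nonneg (f p)
      · exact le_rfl
    exact Real.sqrt_le_sqrt hsq
  · have h0 : bsq (g := toB6 (geo9K i) R₀ H₀) blk y (sliceProjK (κ := κ) ν f) = 0 :=
      bsq_eq_zero_of_loc (g := toB6 (geo9K i) R₀ H₀) blk hy _ fun p hp => by
        rw [sliceProjK_apply, hoff p hp, ite_self]
    show Real.sqrt _ ≤ _
    rw [h0, Real.sqrt_zero]
    exact mul_nonneg (by positivity) (bl2_nonneg _ _ _)

end ProjAny

end Literature.MathematicalPhysics.QuantumFieldTheory.Balaban1983to89.B9DivGradStarKinematicsAtPins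

end
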